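import Literature.Analysis.FluidPDE.OnsagerBDSVNonstationaryPhase
import Literature.Analysis.FluidPDE.OnsagerBDSVStationaryPhaseAntidiv
import Literature.Analysis.FluidPDE.OnsagerBDSVOscillationCorrectorProof
import HarnessLib

/-!
# Non-stationary phase for the antidivergence `ℛ` with composite profiles (BDSV Prop. C.2 (ii), composite form)

Buckmaster–De Lellis–Székelyhidi–Vicol (BDSV), *Onsager's conjecture for admissible weak
solutions*, CPAM 72 (2019) = arXiv:1701.08678, App. C, Prop. C.2, second part:
`‖ℛ(a e^{ik·Φ})‖_α ≲ ‖a‖₀/|k|^{1-α} + (‖a‖_{N+α} + ‖a‖₀‖Φ‖_{N+α})/|k|^{N-α}`, proved in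
Daneri–Székelyhidi 2017, Lemma 2.2 (ii), by `N` integrations by parts (a telescoping identity) and
the Schauder bounds for `ℛ div` and `ℛ`. In §6.1 of BDSV this estimate is applied MODE BY MODE to
the Fourier expansion in `ξ` of composites `f(x) u(R̃(x), λ_{q+1}Φ(x))` of a slowly varying
amplitude `f` with a zero-mean profile `u(R, ξ)` (the Mikado profile `W`, the mean-free tensor
`W ⊗ W - R`, their `R`-derivatives), `R̃ = R̃_{q,i}`, `Φ = Φ_i` — the transport error (6.6)–(6.8) and
the oscillation error `𝒪₁` (6.10)–(6.11).

This file proves the estimate DIRECTLY FOR THE COMPOSITE, with no Fourier series, in the phase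
frame of `OnsagerBDSVNonstationaryPhase.lean` (`BDSV.PhaseFrame`: smooth `R̃` with values in a
compact `𝒦`, smooth displacement `D` with `det ∇Φ = 1`, `Φ = id + D`, frequency `n ≥ 1`, length
`ℓ ∈ (0,1]`, scaled bounds `‖(adj ∇Φ)_{mj}‖_{C^k}, ‖R̃_{ab}‖_{C^k} ≤ Λℓ^{-k}`, `k ≤ K₀`), exactly as
that file proves (C.1) for composites (`BDSV.PhaseFrame.levelBound`) — here with the `C^{0,r}`
norms of `ℛ` in place of `|∫|`:

* the **pointwise telescoping identity** (`BDSV.mul_phaseComp_eq_telescope`,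
  `BDSV.smul_phaseComp_eq_telescope`): with `c_u(x) = u(R̃(x), nΦ(x))` (`BDSV.phaseComp`),
  `A = adj ∇Φ = ∇Φ⁻¹` and the zero-mean primitives `Tⱼ` of `OnsagerBDSVTorusPrimitives.lean`
  (`u = Σⱼ ∂_{ξⱼ} Tⱼu`),
  `(f c_u) • e = n⁻¹ • (div L - Σ_{m,j} (∂ₘ(f A_{mj}) c_{Tⱼu}) • e - Σ_{m,j,a,b} (f A_{mj} ∂ₘR̃_{ab} c_{∂_{R_{ab}}Tⱼu}) • e)`,
  `L` the level tensor with columns `(Σⱼ f A_{mj} c_{Tⱼu}) • e` (`BDSV.levelTensor`); the `9 + 81`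
  lower terms (`BDSV.lowerTerm₁`, `BDSV.lowerTerm₂`) have the same shape one level down;
* the **order-zero Hölder bookkeeping**: the composite at scale `n`,
  `‖c_v‖_{C^{0,r}} ≤ 70 Λ² U n^r` from order-one bounds `U` of `v, ∂_ξ v, ∂_R v` on `𝒦 × T³`
  (`BDSV.ProfileBound`, `BDSV.eContDiffHolderNorm_phaseComp_le`: chain rule, `nℓ ≥ 1`,
  interpolation `Torus.eHolderNorm_le_of_norm_le_of_norm_partialDeriv_le`); the amplitude at scale
  `ℓ`, `‖g‖_{C^{0,r}} ≤ 9 G ℓ^{-r}` from `‖g‖_{C^j} ≤ Gℓ^{-j}`, `j ≤ 1`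
  (`BDSV.ScaledBound.eContDiffHolderNorm_zero_le`); the basic product
  `‖(g c_v) • e‖_{C^{0,r}} ≤ 79 Λ² ‖e‖ G U n^r` (`BDSV.PhaseFrame.holder_mul_phaseComp_smul_le`, sharp
  product rule `BDSV.eContDiffHolderNorm_zero_smul_le_sharp`);
* the **bound family** of the induction (`BDSV.BoundFam K u 𝒦 U`: order-one bounds of `u` and,
  recursively, of the profiles `Tⱼu`, `∂_R Tⱼu` met in `K` rounds), which exists for every jointly
  smooth profile on a compact parameter set (`BDSV.exists_boundFam`);
* the **level bound** (`BDSV.LevelBoundR`, `BDSV.PhaseFrame.levelBoundR`): with the operator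
  constants `C_d`, `C_r` of `‖ℛ div A‖_{0,r} ≤ C_d‖A‖_{0,r}`, `‖ℛ v‖_{0,r} ≤ C_r‖v‖_{0,r}`
  (`BDSV.holder_antidivergence_tensorDivergence_le`, `BDSV.holder_antidivergence_le`, from the proved
  Prop. C.1) and `|∇Φ| ≤ Λ`, `nℓ ≥ 1`, for every `K + 1 ≤ K₀`, every zero-mean jointly smooth `u`
  with a level-`K` bound family `U`, and every smooth `f` with `‖f‖_{C^j} ≤ Fℓ^{-j}` (`j ≤ K+1`),
  `‖ℛ((f c_u) • e)‖_{C^{0,r}} ≤ ‖e‖ F U (a_K n^{-(1-r)} + b_K n^r (nℓ)^{-K})`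
  with explicit coefficients `BDSV.aCoeff`, `BDSV.bCoeff` depending on `K₀, Λ, C_d, C_r` only.
  Level `0` is the `C_r` bound; the step (`BDSV.PhaseFrame.levelBoundR_succ`) is `ℛ` of the
  telescoping identity (`BDSV.antidivergence_smul_phaseComp_eq`), `C_d` on the level tensor (the
  main term `n^{-(1-r)}`) and the induction hypothesis on the `90` lower terms, whose amplitudes
  cost `ℓ⁻¹` (`BDSV.ScaledBound.mul/.partialDeriv`), so that `n⁻¹ℓ⁻¹ = (nℓ)⁻¹ ≤ 1` improves the
  remainder — the printed "`|k|^{-(N-α)}`" mechanism with `|k| ↔ n`, `‖a‖_N ↔ Fℓ^{-N}`.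

This is the analytic engine of the discharge of `𝒪₁` (arXiv (6.11), `BDSV.oscillationPrincipalEstimate`)
and of the transport error (6.8).

## References

* T. Buckmaster, C. De Lellis, L. Székelyhidi Jr., V. Vicol, *Onsager's conjecture for admissible
  weak solutions*, Comm. Pure Appl. Math. 72 (2019) 229–274 = arXiv:1701.08678, App. C,
  Prop. C.2; §6.1.2–6.1.3 (uses); App. A (A.2)–(A.3). [`BuckmasterEtAl2018`]
* S. Daneri, L. Székelyhidi Jr., *Non-uniqueness and h-principle for Hölder-continuous weak
  solutions of the Euler equations*, ARMA 224 (2017) = arXiv:1603.09714, Lemma 2.2 (ii) and its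
  proof (the telescoping identity, the Schauder step). [`DaneriSzekelyhidi2017`]
-/

open MeasureTheory Set Filter
open scoped NNReal ENNReal ContDiff Matrix Matrix.Norms.Elementwise

noncomputable section

namespace Literature.Analysis.FluidPDE

namespace BDSV

open FunctionSpaces FunctionSpaces.Torus

/-- The flat three-torus `T³ = (ℝ/ℤ)³`, local notation. -/
local notation "𝕋³" => UnitAddTorus (Fin 3)

/-- Euclidean `ℝ³`, local notation. -/
local notation "ℝ³" => EuclideanSpace ℝ (Fin 3)

/-- Real `3 × 3` matrices, local notation. -/
local notation "𝕄" => Matrix (Fin 3) (Fin 3) ℝ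

/-! ## The pointwise telescoping identity -/

section Telescoping

variable {u v : 𝕄 → 𝕋³ → ℝ} {Rt : 𝕋³ → 𝕄} {D : 𝕋³ → ℝ³} {f : 𝕋³ → ℝ} {n : ℕ}

/-- Partial derivatives of sums over `Fin 3` of smooth real functions. [folklore] -/
theorem partialDeriv_sum_three {g : Fin 3 → 𝕋³ → ℝ} (hg : ∀ j, IsSmooth (g j)) (m : Fin 3) (x : 𝕋³) :
    Torus.partialDeriv m (fun y => ∑ j, g j y) x = ∑ j, Torus.partialDeriv m (g j) x := by
  have h01 : IsSmooth fun y => g 0 y + g 1 y := (hg 0).add (hg 1)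
  simp only [Fin.sum_univ_three]
  rw [Torus.partialDeriv_add_apply (h01.isContDiff (by simp)) ((hg 2).isContDiff (by simp)),
    Torus.partialDeriv_add_apply ((hg 0).isContDiff (by simp)) ((hg 1).isContDiff (by simp))]

/-- **The zero-mean profile along the frame is a sum of fast derivatives**:
`c_u = Σⱼ c_{∂_{ξⱼ} Tⱼu}` (`u(R,·) = Σⱼ ∂ⱼ Tⱼ(u(R,·))`, `BDSV.eq_sum_partialDeriv_torusPrim`). [folklore] -/
theorem phaseComp_eq_sum_dXi_torusPrim (hu : JointSmooth u) (h0 : ∀ R, ∫ ξ, u R ξ = 0)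
    (Rt : 𝕋³ → 𝕄) (D : 𝕋³ → ℝ³) (n : ℕ) (x : 𝕋³) :
    phaseComp u Rt D n x = ∑ j, phaseComp (dXi j fun R => torusPrim (u R) j) Rt D n x := by
  unfold phaseComp dXi
  exact eq_sum_partialDeriv_torusPrim (hu.isSmooth (Rt x)) (h0 (Rt x)) _

/-- **The pointwise telescoping identity** (one integration by parts, before integrating): for a
jointly smooth zero-mean profile `u`, smooth `f`, `R̃`, `D` with `det ∇Φ = 1` and `n ≠ 0`, with
`A = adj ∇Φ` and `Tⱼ` the zero-mean primitives,
`f c_u = n⁻¹ [Σₘ ∂ₘ(Σⱼ f A_{mj} c_{Tⱼu}) - Σ_{m,j} ∂ₘ(f A_{mj}) c_{Tⱼu} - Σ_{m,j,a,b} f A_{mj} ∂ₘR̃_{ab} c_{∂_{R_{ab}}Tⱼu}]`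
— the mechanism of BDSV Prop. C.2 / Daneri–Székelyhidi Lemma 2.2, for composite profiles.
[cite: BuckmasterEtAl2018, App. C Prop. C.2 (proof)] -/
theorem mul_phaseComp_eq_telescope (hu : JointSmooth u) (h0 : ∀ R, ∫ ξ, u R ξ = 0)
    (hRt : IsSmooth Rt) (hD : IsSmooth D) (hdet : ∀ x, (jac D x).det = 1) (hf : IsSmooth f)
    (hn : n ≠ 0) (x : 𝕋³) :
    f x * phaseComp u Rt D n x =
      (n : ℝ)⁻¹ * ((∑ m, Torus.partialDeriv m (fun y => ∑ j, f y * (jac D y).adjugate m j *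
          phaseComp (fun R => torusPrim (u R) j) Rt D n y) x) -
        (∑ m, ∑ j, Torus.partialDeriv m (fun y => f y * (jac D y).adjugate m j) x *
          phaseComp (fun R => torusPrim (u R) j) Rt D n x) -
        ∑ m, ∑ j, ∑ a, ∑ b, (f x * (jac D x).adjugate m j * Torus.partialDeriv m (fun y => Rt y a b) x) *
          phaseComp (dR (Matrix.single a b 1) fun R => torusPrim (u R) j) Rt D n x) := by
  have hn' : (n : ℝ) ≠ 0 := Nat.cast_ne_zero.2 hn
  have hwj : ∀ j, JointSmooth (fun R => torusPrim (u R) j) := fun j => hu.torusPrim j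
  -- smoothness of the players
  have hA : ∀ m j, IsSmooth fun y => (jac D y).adjugate m j := fun m j =>
    isSmooth_adjugate_jac_entry hD m j
  have hfA : ∀ m j, IsSmooth fun y => f y * (jac D y).adjugate m j := fun m j => hf.mul (hA m j)
  have hcw : ∀ j, IsSmooth (phaseComp (fun R => torusPrim (u R) j) Rt D n) := fun j => (hwj j).phaseComp hRt hD n
  -- step 1: `c_u = Σ_j c_{∂_j w_j}`
  have h1 : phaseComp u Rt D n x = ∑ j, phaseComp (dXi j fun R => torusPrim (u R) j) Rt D n x :=
    phaseComp_eq_sum_dXi_torusPrim hu h0 Rt D n x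
  -- step 2: `n c_{∂_j w_j} = Σ_m A_{mj} ∂_m c_{w_j} - Σ A_{mj} ∂_m R̃_{ab} c_{∂_R w_j}`
  have h2 : ∀ j, (n : ℝ) * phaseComp (dXi j fun R => torusPrim (u R) j) Rt D n x =
      (∑ m, (jac D x).adjugate m j * Torus.partialDeriv m (phaseComp (fun R => torusPrim (u R) j) Rt D n) x) -
        ∑ m, ∑ a, ∑ b, (jac D x).adjugate m j * Torus.partialDeriv m (fun y => Rt y a b) x *
          phaseComp (dR (Matrix.single a b 1) fun R => torusPrim (u R) j) Rt D n x := fun j =>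
    cast_mul_phaseComp_dXi (hwj j) hRt hD n (hdet x) j
  -- step 3: the product rule in the level sum
  have h3 : ∀ m, Torus.partialDeriv m (fun y => ∑ j, f y * (jac D y).adjugate m j *
      phaseComp (fun R => torusPrim (u R) j) Rt D n y) x =
      ∑ j, (Torus.partialDeriv m (fun y => f y * (jac D y).adjugate m j) x * phaseComp (fun R => torusPrim (u R) j) Rt D n x +
        f x * (jac D x).adjugate m j * Torus.partialDeriv m (phaseComp (fun R => torusPrim (u R) j) Rt D n) x) := by
    intro m
    rw [partialDeriv_sum_three (fun j => (hfA m j).mul (hcw j)) m x]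
    refine Finset.sum_congr rfl fun j _ => ?_
    rw [partialDeriv_mul ((hfA m j).isContDiff (by simp)) ((hcw j).isContDiff (by simp))]
    ring
  -- assemble: multiply through by `n`
  rw [eq_comm, inv_mul_eq_iff_eq_mul₀ hn']
  simp only [h3, Finset.sum_add_distrib]
  have h4 : (n : ℝ) * (f x * phaseComp u Rt D n x) =
      ∑ j, f x * ((n : ℝ) * phaseComp (dXi j fun R => torusPrim (u R) j) Rt D n x) := by
    rw [h1, Finset.mul_sum, Finset.mul_sum]
    exact Finset.sum_congr rfl fun j _ => by ring
  rw [h4]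
  simp only [h2, mul_sub, Finset.mul_sum]
  rw [Finset.sum_sub_distrib]
  -- reorder the sums `Σ_j Σ_m ↔ Σ_m Σ_j`
  have e1 : ∑ j, ∑ m, f x * ((jac D x).adjugate m j * Torus.partialDeriv m (phaseComp (fun R => torusPrim (u R) j) Rt D n) x) =
      ∑ m, ∑ j, f x * (jac D x).adjugate m j * Torus.partialDeriv m (phaseComp (fun R => torusPrim (u R) j) Rt D n) x := by
    rw [Finset.sum_comm]
    exact Finset.sum_congr rfl fun m _ => Finset.sum_congr rfl fun j _ => by ring
  have e2 : ∑ j, ∑ m, ∑ a, ∑ b, f x * ((jac D x).adjugate m j * Torus.partialDeriv m (fun y => Rt y a b) x *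
        phaseComp (dR (Matrix.single a b 1) fun R => torusPrim (u R) j) Rt D n x) =
      ∑ m, ∑ j, ∑ a, ∑ b, (f x * (jac D x).adjugate m j * Torus.partialDeriv m (fun y => Rt y a b) x) *
        phaseComp (dR (Matrix.single a b 1) fun R => torusPrim (u R) j) Rt D n x := by
    rw [Finset.sum_comm]
    exact Finset.sum_congr rfl fun m _ => Finset.sum_congr rfl fun j _ =>
      Finset.sum_congr rfl fun a _ => Finset.sum_congr rfl fun b _ => by ring
  rw [e1, e2]
  ring

/-- **The level tensor** of one integration by parts: the tensor field with columns
`m ↦ (Σⱼ f A_{mj} c_{Tⱼu}) • e`, whose `Torus.tensorDivergence` is the exact-divergence part of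
the telescoping identity. [folklore] -/
def levelTensor (u : 𝕄 → 𝕋³ → ℝ) (Rt : 𝕋³ → 𝕄) (D : 𝕋³ → ℝ³) (n : ℕ) (f : 𝕋³ → ℝ) (e : ℝ³)
    (x : 𝕋³) (m : Fin 3) : ℝ³ :=
  (∑ j, f x * (jac D x).adjugate m j * phaseComp (fun R => torusPrim (u R) j) Rt D n x) • e

/-- The scalar in front of `e` in the `m`-th column of the level tensor is smooth. [folklore] -/
theorem isSmooth_levelScalar (hu : JointSmooth u) (hRt : IsSmooth Rt) (hD : IsSmooth D)
    (hf : IsSmooth f) (n : ℕ) (m : Fin 3) :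
    IsSmooth fun x => ∑ j, f x * (jac D x).adjugate m j *
      phaseComp (fun R => torusPrim (u R) j) Rt D n x :=
  Torus.isSmooth_finset_sum _ fun j _ =>
    (hf.mul (isSmooth_adjugate_jac_entry hD m j)).mul ((hu.torusPrim j).phaseComp hRt hD n)

/-- The level tensor is smooth. [folklore] -/
theorem isSmooth_levelTensor (hu : JointSmooth u) (hRt : IsSmooth Rt) (hD : IsSmooth D)
    (hf : IsSmooth f) (n : ℕ) (e : ℝ³) : IsSmooth (levelTensor u Rt D n f e) :=
  contDiff_pi.2 fun m => (isSmooth_levelScalar hu hRt hD hf n m).smul' (isSmooth_const e)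

/-- The divergence of the level tensor: `div L = (Σₘ ∂ₘ(Σⱼ f A_{mj} c_{Tⱼu})) • e`. [folklore] -/
theorem tensorDivergence_levelTensor (hu : JointSmooth u) (hRt : IsSmooth Rt) (hD : IsSmooth D)
    (hf : IsSmooth f) (n : ℕ) (e : ℝ³) (x : 𝕋³) :
    Torus.tensorDivergence (levelTensor u Rt D n f e) x =
      (∑ m, Torus.partialDeriv m (fun y => ∑ j, f y * (jac D y).adjugate m j *
          phaseComp (fun R => torusPrim (u R) j) Rt D n y) x) • e := by
  rw [Torus.tensorDivergence, Finset.sum_smul]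
  refine Finset.sum_congr rfl fun m _ => ?_
  change Torus.partialDeriv m (fun y => (∑ j, f y * (jac D y).adjugate m j *
      phaseComp (fun R => torusPrim (u R) j) Rt D n y) • e) x = _
  rw [partialDeriv_smul ((isSmooth_levelScalar hu hRt hD hf n m).isContDiff (by simp))
    ((isSmooth_const e).isContDiff (by simp)), Torus.partialDeriv_const_apply, smul_zero, zero_add]

/-- **The telescoping identity, vector form**: for `e ∈ ℝ³`,
`(f c_u) • e = n⁻¹ • (div L - Σ_{m,j} (∂ₘ(f A_{mj}) c_{Tⱼu}) • e - Σ_{m,j,a,b} (f A_{mj} ∂ₘR̃_{ab} c_{∂_R Tⱼu}) • e)`.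
[cite: BuckmasterEtAl2018, App. C Prop. C.2 (proof)] -/
theorem smul_phaseComp_eq_telescope (hu : JointSmooth u) (h0 : ∀ R, ∫ ξ, u R ξ = 0)
    (hRt : IsSmooth Rt) (hD : IsSmooth D) (hdet : ∀ x, (jac D x).det = 1) (hf : IsSmooth f)
    (hn : n ≠ 0) (e : ℝ³) :
    (fun x => (f x * phaseComp u Rt D n x) • e) = fun x =>
      (n : ℝ)⁻¹ • (Torus.tensorDivergence (levelTensor u Rt D n f e) x -
        (∑ m, ∑ j, (Torus.partialDeriv m (fun y => f y * (jac D y).adjugate m j) x *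
          phaseComp (fun R => torusPrim (u R) j) Rt D n x) • e) -
        ∑ m, ∑ j, ∑ a, ∑ b, ((f x * (jac D x).adjugate m j * Torus.partialDeriv m (fun y => Rt y a b) x) *
          phaseComp (dR (Matrix.single a b 1) fun R => torusPrim (u R) j) Rt D n x) • e) := by
  funext x
  rw [mul_phaseComp_eq_telescope hu h0 hRt hD hdet hf hn x, tensorDivergence_levelTensor hu hRt hD hf n e x]
  simp only [← Finset.sum_smul, ← sub_smul, smul_smul]

end Telescoping

/-! ## Bounds for profiles and their first derivatives; the bound family of the induction -/

section Profiles

variable {u v : 𝕄 → 𝕋³ → ℝ} {Kset : Set 𝕄} {U U' : ℝ} {K : ℕ}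

/-- **Order-one bounds of a profile on `𝒦 × T³`**: `|v|, |∂_{ξₘ}v|, |∂_{R_{ab}}v| ≤ U` — what the
`C^{0,α}` norm of the composite `c_v` needs. [folklore] -/
def ProfileBound (v : 𝕄 → 𝕋³ → ℝ) (Kset : Set 𝕄) (U : ℝ) : Prop :=
  ∀ R ∈ Kset, ∀ ξ, |v R ξ| ≤ U ∧ (∀ m, |dXi m v R ξ| ≤ U) ∧
    ∀ a b, |dR (Matrix.single a b 1) v R ξ| ≤ U

/-- **The bound family of `K` integrations by parts**: order-one bounds for `u` and, recursively,
the level-`K-1` bound families of the profiles `Tⱼu`, `∂_{R_{ab}}Tⱼu` met one level down. [folklore] -/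
def BoundFam : ℕ → (𝕄 → 𝕋³ → ℝ) → Set 𝕄 → ℝ → Prop
  | 0, u, Kset, U => ProfileBound u Kset U
  | K + 1, u, Kset, U => ProfileBound u Kset U ∧
      ∀ j : Fin 3, BoundFam K (fun R => torusPrim (u R) j) Kset U ∧
        ∀ a b : Fin 3, BoundFam K (dR (Matrix.single a b 1) fun R => torusPrim (u R) j) Kset U

/-- A larger constant. [folklore] -/
theorem ProfileBound.mono (h : ProfileBound v Kset U) (hU : U ≤ U') : ProfileBound v Kset U' :=
  fun R hR ξ => ⟨(h R hR ξ).1.trans hU, fun m => ((h R hR ξ).2.1 m).trans hU,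
    fun a b => ((h R hR ξ).2.2 a b).trans hU⟩

/-- A larger constant. [folklore] -/
theorem BoundFam.mono : ∀ {K : ℕ} {u : 𝕄 → 𝕋³ → ℝ}, BoundFam K u Kset U → U ≤ U' → BoundFam K u Kset U'
  | 0, _, h, hU => ProfileBound.mono h hU
  | _ + 1, _, h, hU => ⟨ProfileBound.mono h.1 hU, fun j => ⟨BoundFam.mono (h.2 j).1 hU,
      fun a b => BoundFam.mono ((h.2 j).2 a b) hU⟩⟩

/-- The order-one bounds contained in a bound family. [folklore] -/
theorem BoundFam.profileBound : ∀ {K : ℕ} {u : 𝕄 → 𝕋³ → ℝ}, BoundFam K u Kset U → ProfileBound u Kset U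
  | 0, _, h => h
  | _ + 1, _, h => h.1

/-- **Order-one bounds exist** for a jointly smooth profile on a compact parameter set (three
continuous families on the compact `𝒦 × T³`). [folklore] -/
theorem exists_profileBound (hK : IsCompact Kset) (hv : JointSmooth v) :
    ∃ U : ℝ, 0 ≤ U ∧ ProfileBound v Kset U := by
  have hb : ∀ w : 𝕄 → 𝕋³ → ℝ, JointSmooth w → ∃ C : ℝ, ∀ R ∈ Kset, ∀ ξ, |w R ξ| ≤ C := by
    intro w hw
    obtain ⟨C, hC⟩ := (hK.prod isCompact_univ).exists_bound_of_continuousOn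
      (f := fun p : 𝕄 × 𝕋³ => w p.1 p.2) hw.continuous.continuousOn
    refine ⟨C, fun R hR ξ => ?_⟩
    have h := hC (R, ξ) ⟨hR, Set.mem_univ _⟩
    rwa [Real.norm_eq_abs] at h
  obtain ⟨C₀, h₀⟩ := hb v hv
  choose C₁ h₁ using fun m => hb _ (hv.dXi m)
  choose C₂ h₂ using fun a b => hb _ (hv.dR (Matrix.single a b 1))
  refine ⟨max (max C₀ 0) (max (∑ m, |C₁ m|) (∑ a, ∑ b, |C₂ a b|)),
    le_trans (le_max_right _ _) (le_max_left _ _), fun R hR ξ => ⟨?_, fun m => ?_, fun a b => ?_⟩⟩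
  · exact (h₀ R hR ξ).trans ((le_max_left _ _).trans (le_max_left _ _))
  · refine ((h₁ m R hR ξ).trans (le_abs_self _)).trans ?_
    refine le_trans ?_ ((le_max_left _ _).trans (le_max_right _ _))
    exact Finset.single_le_sum (f := fun m => |C₁ m|) (fun _ _ => abs_nonneg _) (Finset.mem_univ m)
  · refine ((h₂ a b R hR ξ).trans (le_abs_self _)).trans ?_
    refine le_trans ?_ ((le_max_right _ _).trans (le_max_right _ _))
    exact le_trans (Finset.single_le_sum (f := fun b => |C₂ a b|) (fun _ _ => abs_nonneg _)
      (Finset.mem_univ b)) (Finset.single_le_sum (f := fun a => ∑ b, |C₂ a b|)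
        (fun _ _ => Finset.sum_nonneg fun _ _ => abs_nonneg _) (Finset.mem_univ a))

/-- **Bound families exist** at every level for a jointly smooth profile on a compact parameter
set (induction on the level). [folklore] -/
theorem exists_boundFam (hK : IsCompact Kset) :
    ∀ (K : ℕ) (u : 𝕄 → 𝕋³ → ℝ), JointSmooth u → ∃ U : ℝ, 0 ≤ U ∧ BoundFam K u Kset U := by
  intro K
  induction K with
  | zero => exact fun u hu => exists_profileBound hK hu
  | succ K ih =>
    intro u hu
    obtain ⟨U₀, hU₀0, hU₀⟩ := exists_profileBound hK hu
    have hT : ∀ j, JointSmooth fun R => torusPrim (u R) j := fun j => hu.torusPrim j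
    choose U₁ hU₁0 hU₁ using fun j => ih _ (hT j)
    choose U₂ hU₂0 hU₂ using fun j a b => ih _ ((hT j).dR (Matrix.single a b 1))
    set U : ℝ := U₀ + ∑ j, (U₁ j + ∑ a, ∑ b, U₂ j a b) with hUdef
    have hS2 : ∀ j, 0 ≤ ∑ a, ∑ b, U₂ j a b := fun j =>
      Finset.sum_nonneg fun a _ => Finset.sum_nonneg fun b _ => hU₂0 j a b
    have hS : 0 ≤ ∑ j, (U₁ j + ∑ a, ∑ b, U₂ j a b) :=
      Finset.sum_nonneg fun j _ => add_nonneg (hU₁0 j) (hS2 j)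
    have hj : ∀ j, U₁ j + ∑ a, ∑ b, U₂ j a b ≤ ∑ j, (U₁ j + ∑ a, ∑ b, U₂ j a b) := fun j =>
      Finset.single_le_sum (f := fun j => U₁ j + ∑ a, ∑ b, U₂ j a b)
        (fun j _ => add_nonneg (hU₁0 j) (hS2 j)) (Finset.mem_univ j)
    have hab : ∀ j a b, U₂ j a b ≤ ∑ a, ∑ b, U₂ j a b := fun j a b =>
      le_trans (Finset.single_le_sum (f := fun b => U₂ j a b) (fun b _ => hU₂0 j a b) (Finset.mem_univ b))
        (Finset.single_le_sum (f := fun a => ∑ b, U₂ j a b)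
          (fun a _ => Finset.sum_nonneg fun b _ => hU₂0 j a b) (Finset.mem_univ a))
    refine ⟨U, add_nonneg hU₀0 hS, hU₀.mono (le_add_of_nonneg_right hS), fun j => ⟨?_, fun a b => ?_⟩⟩
    · exact (hU₁ j).mono (by linarith [hj j, hS2 j])
    · exact (hU₂ j a b).mono (by linarith [hj j, hab j a b, hU₁0 j])

end Profiles

/-! ## Hölder norms at order zero: composites and scaled amplitudes -/

section Holder

variable {v : 𝕄 → 𝕋³ → ℝ} {Rt : 𝕋³ → 𝕄} {D : 𝕋³ → ℝ³} {n : ℕ} {Kset : Set 𝕄}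

/-- `(p : ℝ≥0∞) = ENNReal.ofReal p` for `p : ℝ≥0`. [folklore] -/
theorem coe_nnreal_eq_ofReal (p : ℝ≥0) : (p : ℝ≥0∞) = ENNReal.ofReal (p : ℝ) :=
  (ENNReal.ofReal_coe_nnreal).symm

/-- **The composite in `C^{0,r}` at scale `n`**: if `|v|, |∂_ξ v|, |∂_R v| ≤ U` on `𝒦 × T³`,
`|∇Φ| ≤ Λ`, `|∂R̃| ≤ Λℓ⁻¹`, `nℓ ≥ 1`, then `‖c_v‖_{C^{0,r}} ≤ 70 Λ² U n^r` (the chain rule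
`∂ₘ c_v = Σ ∂ₘR̃_{ab} c_{∂_R v} + n Σₖ (∇Φ)_{km} c_{∂_ξ v}` gives the Lipschitz bound `12ΛnU`,
interpolated against the oscillation `2U` at scale `n⁻¹`; cf. `‖cos(2πm·Φ)‖_{0,α} ≤ (2πĈ+3)|m|^α`).
[cite: BuckmasterEtAl2018, App. C Prop. C.2 (proof)] -/
theorem eContDiffHolderNorm_phaseComp_le (hv : JointSmooth v) (hRt : IsSmooth Rt) (hD : IsSmooth D)
    (hmem : ∀ x, Rt x ∈ Kset) {U Λ ℓ : ℝ} (hU : 0 ≤ U) (hΛ : 1 ≤ Λ) (hℓ : 0 < ℓ)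
    (hvB : ProfileBound v Kset U) (hJ : ∀ x k m, |jac D x k m| ≤ Λ)
    (hRt1 : ∀ a b m x, |Torus.partialDeriv m (fun y => Rt y a b) x| ≤ Λ * ℓ⁻¹)
    (hn : 0 < n) (hnl : 1 ≤ (n : ℝ) * ℓ) {r : ℝ≥0} (hr1 : r ≤ 1) :
    Torus.eContDiffHolderNorm 0 r (phaseComp v Rt D n) ≤
      ENNReal.ofReal (70 * Λ ^ 2 * U * (n : ℝ) ^ (r : ℝ)) := by
  have hc : IsSmooth (phaseComp v Rt D n) := hv.phaseComp hRt hD n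
  have hnr : (0 : ℝ) < n := Nat.cast_pos.2 hn
  have hn1 : (1 : ℝ) ≤ n := by exact_mod_cast hn
  have hΛ0 : 0 ≤ Λ := zero_le_one.trans hΛ
  have hli : ℓ⁻¹ ≤ n := by
    rw [inv_le_iff_one_le_mul₀ hℓ]
    exact hnl
  -- pointwise bounds on `c_v` and `∂ₘ c_v`
  have hM₁ : 0 ≤ 12 * Λ * n * U := by positivity
  set M₀ : ℝ≥0 := ⟨U, hU⟩ with hM₀def
  set M₁ : ℝ≥0 := ⟨12 * Λ * n * U, hM₁⟩ with hM₁def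
  set N : ℝ≥0 := ⟨(n : ℝ), hnr.le⟩ with hNdef
  have eM₀ : (M₀ : ℝ) = U := rfl
  have eM₁ : (M₁ : ℝ) = 12 * Λ * n * U := rfl
  have eN : (N : ℝ) = n := rfl
  have h0 : ∀ x, ‖phaseComp v Rt D n x‖ ≤ (M₀ : ℝ) := fun x => by
    rw [Real.norm_eq_abs, eM₀]
    exact (hvB (Rt x) (hmem x) _).1
  have h1 : ∀ m x, ‖Torus.partialDeriv m (phaseComp v Rt D n) x‖ ≤ (M₁ : ℝ) := by
    intro m x
    rw [Real.norm_eq_abs, eM₁, partialDeriv_phaseComp hv hRt hD n m x]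
    have hA : |∑ a, ∑ b, Torus.partialDeriv m (fun y => Rt y a b) x *
        phaseComp (dR (Matrix.single a b 1) v) Rt D n x| ≤ 9 * (Λ * ℓ⁻¹ * U) := by
      have hab : ∀ a b, |Torus.partialDeriv m (fun y => Rt y a b) x *
          phaseComp (dR (Matrix.single a b 1) v) Rt D n x| ≤ Λ * ℓ⁻¹ * U := by
        intro a b
        rw [abs_mul]
        exact mul_le_mul (hRt1 a b m x) ((hvB (Rt x) (hmem x) _).2.2 a b) (abs_nonneg _)
          (by positivity)
      refine (Finset.abs_sum_le_sum_abs _ _).trans ?_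
      refine (Finset.sum_le_sum fun a _ => (Finset.abs_sum_le_sum_abs _ _).trans
        (Finset.sum_le_sum fun b _ => hab a b)).trans ?_
      simp only [Finset.sum_const, Finset.card_univ, Fintype.card_fin]
      norm_num
      linarith
    have hB : |(n : ℝ) * ∑ k, jac D x k m * phaseComp (dXi k v) Rt D n x| ≤ n * (3 * (Λ * U)) := by
      rw [abs_mul, abs_of_nonneg hnr.le]
      refine mul_le_mul_of_nonneg_left ?_ hnr.le
      have hk : ∀ k, |jac D x k m * phaseComp (dXi k v) Rt D n x| ≤ Λ * U := by
        intro k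
        rw [abs_mul]
        exact mul_le_mul (hJ x k m) ((hvB (Rt x) (hmem x) _).2.1 k) (abs_nonneg _) hΛ0
      refine (Finset.abs_sum_le_sum_abs _ _).trans ((Finset.sum_le_sum fun k _ => hk k).trans ?_)
      simp
    refine (abs_add_le _ _).trans ?_
    refine (add_le_add hA hB).trans ?_
    have hΛU : 0 ≤ Λ * U := mul_nonneg hΛ0 hU
    nlinarith [mul_le_mul_of_nonneg_left hli hΛU]
  -- interpolation at scale `n⁻¹`
  have hN0 : 0 < N := hnr
  have hH := eHolderNorm_le_of_norm_le_of_norm_partialDeriv_le (hc.isContDiff (by simp)) hr1 hN0 h0 h1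
  have hsup : eSupNorm (phaseComp v Rt D n) ≤ ENNReal.ofReal U := by
    refine eSupNorm_le_ofReal fun x => ?_
    rw [← eM₀]
    exact h0 x
  refine (eContDiffHolderNorm_zero_le_eBoundedHolderNorm r _).trans ?_
  rw [eBoundedHolderNorm]
  refine (add_le_add hsup hH).trans ?_
  rw [coe_nnreal_eq_ofReal, ← ENNReal.ofReal_add hU (NNReal.coe_nonneg _)]
  refine ENNReal.ofReal_le_ofReal ?_
  -- the real inequality `U + (√3·3·(12ΛnU)·n^{-(1-r)} + 2U n^r) ≤ 70 Λ² U n^r`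
  have hnr' : (1 : ℝ) ≤ (n : ℝ) ^ (r : ℝ) := Real.one_le_rpow hn1 (NNReal.coe_nonneg r)
  have hpow : (n : ℝ) * ((n : ℝ)⁻¹) ^ (1 - r : ℝ) = (n : ℝ) ^ (r : ℝ) := by
    rw [Real.inv_rpow hnr.le, ← Real.rpow_neg hnr.le]
    have e : (n : ℝ) * (n : ℝ) ^ (-(1 - (r : ℝ))) = (n : ℝ) ^ (1 : ℝ) * (n : ℝ) ^ (-(1 - (r : ℝ))) := by
      rw [Real.rpow_one]
    rw [e, ← Real.rpow_add hnr]
    congr 1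
    ring
  have hs3 : Real.sqrt 3 ≤ 7 / 4 := by
    rw [show (7 / 4 : ℝ) = Real.sqrt ((7 / 4) ^ 2) by rw [Real.sqrt_sq (by norm_num)]]
    exact Real.sqrt_le_sqrt (by norm_num)
  push_cast
  rw [Fintype.card_fin, eM₀, eM₁, eN]
  push_cast
  have hΛ2 : Λ ≤ Λ ^ 2 := by nlinarith
  have key : Real.sqrt 3 * (3 * (12 * Λ * n * U)) * (n : ℝ)⁻¹ ^ (1 - (r : ℝ)) =
      36 * Real.sqrt 3 * Λ * U * (n : ℝ) ^ (r : ℝ) := by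
    rw [← hpow]; ring
  rw [key]
  have hX : 0 ≤ U * (n : ℝ) ^ (r : ℝ) := by positivity
  nlinarith [mul_le_mul_of_nonneg_right hs3 (by positivity : 0 ≤ 36 * Λ * U * (n : ℝ) ^ (r : ℝ)),
    mul_le_mul_of_nonneg_right hΛ2 hX, mul_le_mul_of_nonneg_right hΛ hX,
    mul_le_mul_of_nonneg_left hnr' hU, mul_nonneg (sq_nonneg Λ) hX]

/-- `x · (x⁻¹)^{1-r} = x^r` for `x > 0`. [folklore] -/
theorem mul_inv_rpow_one_sub {x : ℝ} (hx : 0 < x) (r : ℝ) : x * x⁻¹ ^ (1 - r) = x ^ r := by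
  rw [Real.inv_rpow hx.le, ← Real.rpow_neg hx.le]
  have e : x * x ^ (-(1 - r)) = x ^ (1 : ℝ) * x ^ (-(1 - r)) := by rw [Real.rpow_one]
  rw [e, ← Real.rpow_add hx]
  congr 1
  ring

/-- **A scaled amplitude in `C^{0,r}` at scale `ℓ`**: `‖g‖_{C^j} ≤ G ℓ^{-j}` (`j ≤ 1`) gives
`‖g‖_{C^{0,r}} ≤ 9 G ℓ^{-r}` (interpolation of the Lipschitz bound `Gℓ⁻¹` against the oscillation
`2G` at scale `ℓ`; BDSV App. A (A.3)). [cite: BuckmasterEtAl2018, App. A (A.3)] -/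
theorem ScaledBound.eContDiffHolderNorm_zero_le {g : 𝕋³ → ℝ} {ℓ G : ℝ} (hg : ScaledBound g 1 ℓ G)
    (hgs : IsSmooth g) (hG : 0 ≤ G) (hℓ : 0 < ℓ) (hℓ1 : ℓ ≤ 1) {r : ℝ≥0} (hr1 : r ≤ 1) :
    Torus.eContDiffHolderNorm 0 r g ≤ ENNReal.ofReal (9 * G * ℓ⁻¹ ^ (r : ℝ)) := by
  have hli0 : 0 < ℓ⁻¹ := inv_pos.2 hℓ
  have hli1 : 1 ≤ ℓ⁻¹ := (one_le_inv₀ hℓ).2 hℓ1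
  have hGl : 0 ≤ G * ℓ⁻¹ := mul_nonneg hG hli0.le
  set M₀ : ℝ≥0 := ⟨G, hG⟩ with hM₀def
  set M₁ : ℝ≥0 := ⟨G * ℓ⁻¹, hGl⟩ with hM₁def
  set N : ℝ≥0 := ⟨ℓ⁻¹, hli0.le⟩ with hNdef
  have eM₀ : (M₀ : ℝ) = G := rfl
  have eM₁ : (M₁ : ℝ) = G * ℓ⁻¹ := rfl
  have eN : (N : ℝ) = ℓ⁻¹ := rfl
  have hg0 := hg 0 (by norm_num)
  have hg1 := hg 1 le_rfl
  rw [pow_zero, mul_one] at hg0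
  rw [pow_one] at hg1
  have h0 : ∀ x, ‖g x‖ ≤ (M₀ : ℝ) := fun x => norm_le_of_eContDiffHolderNorm_zero_le hG hg0 x
  have h1 : ∀ m x, ‖Torus.partialDeriv m g x‖ ≤ (M₁ : ℝ) := fun m x =>
    norm_partialDeriv_le_of_eContDiffHolderNorm_le (hgs.isContDiff (by simp)) hGl hg1 m x
  have hN0 : 0 < N := hli0
  have hH := eHolderNorm_le_of_norm_le_of_norm_partialDeriv_le (hgs.isContDiff (by simp)) hr1 hN0 h0 h1
  have hsup : eSupNorm g ≤ ENNReal.ofReal G := eSupNorm_le_ofReal fun x => h0 x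
  refine (eContDiffHolderNorm_zero_le_eBoundedHolderNorm r _).trans ?_
  rw [eBoundedHolderNorm]
  refine (add_le_add hsup hH).trans ?_
  rw [coe_nnreal_eq_ofReal, ← ENNReal.ofReal_add hG (NNReal.coe_nonneg _)]
  refine ENNReal.ofReal_le_ofReal ?_
  have hlr : (1 : ℝ) ≤ ℓ⁻¹ ^ (r : ℝ) := Real.one_le_rpow hli1 (NNReal.coe_nonneg r)
  have hs3 : Real.sqrt 3 ≤ 7 / 4 := by
    rw [show (7 / 4 : ℝ) = Real.sqrt ((7 / 4) ^ 2) by rw [Real.sqrt_sq (by norm_num)]]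
    exact Real.sqrt_le_sqrt (by norm_num)
  push_cast
  rw [Fintype.card_fin, eM₀, eM₁, eN]
  push_cast
  have key : Real.sqrt 3 * (3 * (G * ℓ⁻¹)) * (ℓ⁻¹)⁻¹ ^ (1 - (r : ℝ)) =
      3 * Real.sqrt 3 * G * ℓ⁻¹ ^ (r : ℝ) := by
    rw [← mul_inv_rpow_one_sub hli0]; ring
  rw [key]
  have hX : 0 ≤ G * ℓ⁻¹ ^ (r : ℝ) := by positivity
  nlinarith [mul_le_mul_of_nonneg_right hs3 (by positivity : 0 ≤ 3 * G * ℓ⁻¹ ^ (r : ℝ)),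
    mul_le_mul_of_nonneg_left hlr hG]

/-- `‖s • e‖_{C^{0,r}} ≤ ‖e‖ ‖s‖_{C^{0,r}}` for a real function `s` and a fixed vector `e`
(post-composition with `t ↦ t • e`). [folklore] -/
theorem eContDiffHolderNorm_smul_const_le (r : ℝ≥0) (s : 𝕋³ → ℝ) (e : ℝ³) :
    Torus.eContDiffHolderNorm 0 r (fun x => s x • e) ≤
      ENNReal.ofReal ‖e‖ * Torus.eContDiffHolderNorm 0 r s := by
  have h := eContDiffHolderNorm_zero_clm_comp_le (ContinuousLinearMap.toSpanSingleton ℝ e) r s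
  simp only [ContinuousLinearMap.toSpanSingleton_apply, ContinuousLinearMap.nnnorm_toSpanSingleton] at h
  rw [ofReal_norm, enorm_eq_nnnorm]
  exact h

variable {K₀ : ℕ} {ℓ Λ : ℝ}

/-- In a phase frame, `|(adj ∇Φ)_{mj}| ≤ Λ`. [folklore] -/
theorem PhaseFrame.abs_adj_le (hP : PhaseFrame Rt D n K₀ ℓ Λ Kset) (x : 𝕋³) (m j : Fin 3) :
    |(jac D x).adjugate m j| ≤ Λ :=
  (hP.adj_bound m j).abs_le (zero_le_one.trans hP.one_le_Λ) x

/-- In a phase frame of level `≥ 1`, `|∂ₘ R̃_{ab}| ≤ Λ ℓ⁻¹`. [folklore] -/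
theorem PhaseFrame.abs_partialDeriv_Rt_le (hP : PhaseFrame Rt D n K₀ ℓ Λ Kset) (hK : 1 ≤ K₀)
    (a b m : Fin 3) (x : 𝕋³) : |Torus.partialDeriv m (fun y => Rt y a b) x| ≤ Λ * ℓ⁻¹ := by
  have h := hP.Rt_bound a b 1 hK
  rw [pow_one] at h
  have hΛ : 0 ≤ Λ * ℓ⁻¹ := mul_nonneg (zero_le_one.trans hP.one_le_Λ) (inv_nonneg.2 hP.ℓ_pos.le)
  have := norm_partialDeriv_le_of_eContDiffHolderNorm_le
    ((isSmooth_entry hP.smooth_Rt a b).isContDiff (by simp)) hΛ h m x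
  rwa [Real.norm_eq_abs] at this

/-- `ℓ^{-r} ≤ n^r` when `nℓ ≥ 1`. [folklore] -/
theorem inv_rpow_le_rpow_of_one_le_mul {ℓ : ℝ} {n : ℕ} (hℓ : 0 < ℓ) (hnl : 1 ≤ (n : ℝ) * ℓ)
    {r : ℝ} (hr : 0 ≤ r) : ℓ⁻¹ ^ r ≤ (n : ℝ) ^ r :=
  Real.rpow_le_rpow (inv_nonneg.2 hℓ.le) ((inv_le_iff_one_le_mul₀ hℓ).2 hnl) hr

/-- **The basic product `(g c_v) • e` in `C^{0,r}`**: in a phase frame of level `≥ 1` with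
`nℓ ≥ 1` and `|∇Φ| ≤ Λ`, for a smooth `g` with `‖g‖_{C^j} ≤ Gℓ^{-j}` (`j ≤ 1`) and a jointly smooth
profile `v` with order-one bounds `U`,
`‖(g c_v) • e‖_{C^{0,r}} ≤ 79 Λ² ‖e‖ G U n^r` (sharp product rule, the composite at scale `n`, the
amplitude at scale `ℓ ≥ n⁻¹`). [cite: BuckmasterEtAl2018, App. C Prop. C.2 (proof)] -/
theorem PhaseFrame.holder_mul_phaseComp_smul_le (hP : PhaseFrame Rt D n K₀ ℓ Λ Kset) (hK : 1 ≤ K₀)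
    (hnl : 1 ≤ (n : ℝ) * ℓ) (hJ : ∀ x k m, |jac D x k m| ≤ Λ) {g : 𝕋³ → ℝ} (hgs : IsSmooth g)
    {G : ℝ} (hG : 0 ≤ G) (hgB : ScaledBound g 1 ℓ G) (hv : JointSmooth v) {U : ℝ} (hU : 0 ≤ U)
    (hvB : ProfileBound v Kset U) (e : ℝ³) {r : ℝ≥0} (hr1 : r ≤ 1) :
    Torus.eContDiffHolderNorm 0 r (fun x => (g x * phaseComp v Rt D n x) • e) ≤
      ENNReal.ofReal (79 * Λ ^ 2 * ‖e‖ * G * U * (n : ℝ) ^ (r : ℝ)) := by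
  have hℓ := hP.ℓ_pos
  have hΛ1 := hP.one_le_Λ
  have hΛ0 : 0 ≤ Λ := zero_le_one.trans hΛ1
  have hnr : (0 : ℝ) ≤ n := Nat.cast_nonneg n
  have hc := eContDiffHolderNorm_phaseComp_le hv hP.smooth_Rt hP.smooth_D hP.mem hU hΛ1 hℓ hvB hJ
    (hP.abs_partialDeriv_Rt_le hK) hP.n_pos hnl hr1
  have hgH := hgB.eContDiffHolderNorm_zero_le hgs hG hℓ hP.ℓ_le_one hr1
  have hg0 : eSupNorm g ≤ ENNReal.ofReal G := by
    refine eSupNorm_le_ofReal fun x => ?_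
    rw [Real.norm_eq_abs]
    exact hgB.abs_le hG x
  have hc0 : eSupNorm (phaseComp v Rt D n) ≤ ENNReal.ofReal U := by
    refine eSupNorm_le_ofReal fun x => ?_
    rw [Real.norm_eq_abs]
    exact (hvB (Rt x) (hP.mem x) _).1
  have hprod := eContDiffHolderNorm_zero_smul_le_sharp r g (phaseComp v Rt D n)
  simp only [smul_eq_mul] at hprod
  refine (eContDiffHolderNorm_smul_const_le r _ e).trans ?_
  refine (mul_le_mul_of_nonneg_left (hprod.trans (add_le_add (mul_le_mul hg0 hc bot_le bot_le)
    (mul_le_mul hgH hc0 bot_le bot_le))) bot_le).trans ?_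
  have h70 : 0 ≤ 70 * Λ ^ 2 * U * (n : ℝ) ^ (r : ℝ) := by positivity
  have h9 : 0 ≤ 9 * G * ℓ⁻¹ ^ (r : ℝ) := by positivity
  rw [← ENNReal.ofReal_mul hG, ← ENNReal.ofReal_mul h9, ← ENNReal.ofReal_add (mul_nonneg hG h70)
    (mul_nonneg h9 hU), ← ENNReal.ofReal_mul (norm_nonneg e)]
  refine ENNReal.ofReal_le_ofReal ?_
  have hlr : ℓ⁻¹ ^ (r : ℝ) ≤ (n : ℝ) ^ (r : ℝ) := inv_rpow_le_rpow_of_one_le_mul hℓ hnl r.coe_nonneg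
  have hΛ2 : 1 ≤ Λ ^ 2 := one_le_pow₀ hΛ1
  have hX : 0 ≤ ‖e‖ * G * U := by positivity
  have hY : 0 ≤ ‖e‖ * G * U * (n : ℝ) ^ (r : ℝ) := by positivity
  nlinarith [mul_le_mul_of_nonneg_left hlr hX, mul_le_mul_of_nonneg_right hΛ2 hY]

end Holder

/-! ## The level bound for `ℛ`: induction on the number of integrations by parts -/

section Level

variable {Rt : 𝕋³ → 𝕄} {D : 𝕋³ → ℝ³} {n K₀ : ℕ} {ℓ Λ : ℝ} {Kset : Set 𝕄}

/-- Finite sums of smooth fields, as `Pi` sums, are smooth. [folklore] -/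
theorem isSmooth_sum_pi {ι : Type*} {F : Type*} [NormedAddCommGroup F] [NormedSpace ℝ F] (s : Finset ι)
    {w : ι → 𝕋³ → F} (hw : ∀ i ∈ s, IsSmooth (w i)) : IsSmooth (∑ i ∈ s, w i) := by
  have h := Torus.isSmooth_finset_sum s hw
  convert h using 1
  funext x
  simp [Finset.sum_apply]

/-- **The level-`K` bound for `ℛ`** with coefficients `a, b`: for every jointly smooth zero-mean
profile `u` with a level-`K` bound family `U`, and every smooth amplitude `f` with
`‖f‖_{C^j} ≤ Fℓ^{-j}` (`j ≤ K+1`),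
`‖ℛ((f c_u) • e)‖_{C^{0,r}} ≤ ‖e‖ F U (a n^{-(1-r)} + b n^r (nℓ)^{-K})`. [folklore] -/
def LevelBoundR (Rt : 𝕋³ → 𝕄) (D : 𝕋³ → ℝ³) (n : ℕ) (ℓ : ℝ) (Kset : Set 𝕄) (r : ℝ≥0) (e : ℝ³)
    (a b : ℝ) (K : ℕ) : Prop :=
  ∀ (u : 𝕄 → 𝕋³ → ℝ) (f : 𝕋³ → ℝ) (F U : ℝ), JointSmooth u → (∀ R, ∫ ξ, u R ξ = 0) → IsSmooth f →
    0 ≤ F → ScaledBound f (K + 1) ℓ F → 0 ≤ U → BoundFam K u Kset U →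
      Torus.eContDiffHolderNorm 0 r (Torus.antidivergence fun x => (f x * phaseComp u Rt D n x) • e) ≤
        ENNReal.ofReal (‖e‖ * F * U * (a * (n : ℝ) ^ (-1 + (r : ℝ)) +
          b * (n : ℝ) ^ (r : ℝ) * (((n : ℝ) * ℓ)⁻¹) ^ K))

variable {r : ℝ≥0} {Cd Cr : ℝ≥0} {e : ℝ³}

/-- **Level `0`**: `‖ℛ((f c_u)•e)‖_{0,r} ≤ C_r ‖(f c_u)•e‖_{0,r} ≤ 79 Λ² C_r ‖e‖ F U n^r`.
[cite: BuckmasterEtAl2018, App. C Prop. C.2 (proof)] -/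
theorem PhaseFrame.levelBoundR_zero (hP : PhaseFrame Rt D n K₀ ℓ Λ Kset) (hK : 1 ≤ K₀)
    (hnl : 1 ≤ (n : ℝ) * ℓ) (hJ : ∀ x k m, |jac D x k m| ≤ Λ) (hr1 : r ≤ 1)
    (hCr : ∀ w : 𝕋³ → ℝ³, IsSmooth w →
      Torus.eContDiffHolderNorm 0 r (Torus.antidivergence w) ≤ Cr * Torus.eContDiffHolderNorm 0 r w)
    (e : ℝ³) : LevelBoundR Rt D n ℓ Kset r e 0 (79 * Λ ^ 2 * Cr) 0 := by
  intro u f F U hu _ hf hF hfB hU hUB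
  have hg : IsSmooth fun x => (f x * phaseComp u Rt D n x) • e :=
    (hf.mul (hu.phaseComp hP.smooth_Rt hP.smooth_D n)).smul' (isSmooth_const e)
  refine ((hCr _ hg).trans (mul_le_mul_of_nonneg_left (hP.holder_mul_phaseComp_smul_le hK hnl hJ hf hF
    hfB hu hU hUB e hr1) bot_le)).trans ?_
  rw [coe_nnreal_eq_ofReal, ← ENNReal.ofReal_mul (NNReal.coe_nonneg _)]
  refine ENNReal.ofReal_le_ofReal (le_of_eq ?_)
  rw [pow_zero]
  ring

/-- The Leibniz constant `3^{K₀+1}(K₀+2)`, dominating the constants `3^N(N+1)` of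
`BDSV.ScaledBound.mul` for `N ≤ K₀ + 1`. [folklore] -/
def leibConst (K₀ : ℕ) : ℝ := (3 : ℝ) ^ (K₀ + 1) * (K₀ + 2)

/-- `1 ≤ leibConst K₀`. [folklore] -/
theorem one_le_leibConst (K₀ : ℕ) : 1 ≤ leibConst K₀ := by
  unfold leibConst
  have h3 : (1 : ℝ) ≤ 3 ^ (K₀ + 1) := one_le_pow₀ (by norm_num)
  have hK : (1 : ℝ) ≤ K₀ + 2 := by
    have := Nat.cast_nonneg (α := ℝ) K₀; linarith
  nlinarith

/-- `3^N (N+1) ≤ leibConst K₀` for `N ≤ K₀ + 1`. [folklore] -/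
theorem leib_le {N K₀ : ℕ} (h : N ≤ K₀ + 1) : (3 : ℝ) ^ N * (N + 1) ≤ leibConst K₀ := by
  unfold leibConst
  have h1 : (3 : ℝ) ^ N ≤ 3 ^ (K₀ + 1) := pow_le_pow_right₀ (by norm_num) h
  have h2 : ((N : ℝ) + 1) ≤ K₀ + 2 := by
    have : (N : ℝ) ≤ K₀ + 1 := by exact_mod_cast h
    linarith
  exact mul_le_mul h1 h2 (by positivity) (by positivity)

/-- `Σ_{m : Fin 3} X = 3X` in `ℝ≥0∞`. [folklore] -/
theorem sum_fin_three_const (X : ℝ≥0∞) : ∑ _m : Fin 3, X = 3 * X := by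
  simp [Finset.sum_const, Finset.card_univ]

/-- `k · ofReal B = ofReal (k B)` for `k ∈ ℕ`. [folklore] -/
theorem natCast_mul_ofReal (k : ℕ) (B : ℝ) : (k : ℝ≥0∞) * ENNReal.ofReal B = ENNReal.ofReal (k * B) := by
  rw [ENNReal.ofReal_mul (Nat.cast_nonneg k), ENNReal.ofReal_natCast]

/-! ### The lower terms of the telescoping identity and `ℛ` of the identity -/

/-- The first family of lower terms, `(∂ₘ(f A_{mj}) c_{Tⱼu}) • e`. [folklore] -/
def lowerTerm₁ (u : 𝕄 → 𝕋³ → ℝ) (Rt : 𝕋³ → 𝕄) (D : 𝕋³ → ℝ³) (n : ℕ) (f : 𝕋³ → ℝ) (e : ℝ³)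
    (m j : Fin 3) (x : 𝕋³) : ℝ³ :=
  (Torus.partialDeriv m (fun y => f y * (jac D y).adjugate m j) x *
    phaseComp (fun R => torusPrim (u R) j) Rt D n x) • e

/-- The second family of lower terms, `(f A_{mj} ∂ₘR̃_{ab} c_{∂_{R_{ab}}Tⱼu}) • e`. [folklore] -/
def lowerTerm₂ (u : 𝕄 → 𝕋³ → ℝ) (Rt : 𝕋³ → 𝕄) (D : 𝕋³ → ℝ³) (n : ℕ) (f : 𝕋³ → ℝ) (e : ℝ³)
    (m j a b : Fin 3) (x : 𝕋³) : ℝ³ :=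
  ((f x * (jac D x).adjugate m j * Torus.partialDeriv m (fun y => Rt y a b) x) *
    phaseComp (dR (Matrix.single a b 1) fun R => torusPrim (u R) j) Rt D n x) • e

variable {u : 𝕄 → 𝕋³ → ℝ} {f : 𝕋³ → ℝ}

/-- The first lower terms are smooth. [folklore] -/
theorem isSmooth_lowerTerm₁ (hu : JointSmooth u) (hRt : IsSmooth Rt) (hD : IsSmooth D)
    (hf : IsSmooth f) (n : ℕ) (e : ℝ³) (m j : Fin 3) : IsSmooth (lowerTerm₁ u Rt D n f e m j) :=
  (((hf.mul (isSmooth_adjugate_jac_entry hD m j)).partialDeriv m).mul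
    ((hu.torusPrim j).phaseComp hRt hD n)).smul' (isSmooth_const e)

/-- The second lower terms are smooth. [folklore] -/
theorem isSmooth_lowerTerm₂ (hu : JointSmooth u) (hRt : IsSmooth Rt) (hD : IsSmooth D)
    (hf : IsSmooth f) (n : ℕ) (e : ℝ³) (m j a b : Fin 3) : IsSmooth (lowerTerm₂ u Rt D n f e m j a b) :=
  (((hf.mul (isSmooth_adjugate_jac_entry hD m j)).mul ((isSmooth_entry hRt a b).partialDeriv m)).mul
    (((hu.torusPrim j).dR _).phaseComp hRt hD n)).smul' (isSmooth_const e)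

/-- The divergence of the level tensor is smooth. [folklore] -/
theorem isSmooth_tensorDivergence_levelTensor (hu : JointSmooth u) (hRt : IsSmooth Rt) (hD : IsSmooth D)
    (hf : IsSmooth f) (n : ℕ) (e : ℝ³) : IsSmooth (Torus.tensorDivergence (levelTensor u Rt D n f e)) :=
  Torus.isSmooth_finset_sum Finset.univ fun l _ =>
    ((isSmooth_levelTensor hu hRt hD hf n e).column l).partialDeriv l

/-- **`ℛ` of the telescoping identity**: by linearity of `ℛ` on smooth fields,
`ℛ((f c_u)•e) = n⁻¹ • (ℛ div L - Σ_{m,j} ℛ(lowerTerm₁) - Σ_{m,j,a,b} ℛ(lowerTerm₂))`.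
[cite: BuckmasterEtAl2018, App. C Prop. C.2 (proof)] -/
theorem antidivergence_smul_phaseComp_eq (hu : JointSmooth u) (h0 : ∀ R, ∫ ξ, u R ξ = 0)
    (hRt : IsSmooth Rt) (hD : IsSmooth D) (hdet : ∀ x, (jac D x).det = 1) (hf : IsSmooth f)
    (hn : n ≠ 0) (e : ℝ³) :
    Torus.antidivergence (fun x => (f x * phaseComp u Rt D n x) • e) =
      (n : ℝ)⁻¹ • (Torus.antidivergence (Torus.tensorDivergence (levelTensor u Rt D n f e)) -
        (∑ m, ∑ j, Torus.antidivergence (lowerTerm₁ u Rt D n f e m j)) -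
        ∑ m, ∑ j, ∑ a, ∑ b, Torus.antidivergence (lowerTerm₂ u Rt D n f e m j a b)) := by
  have h₁ := isSmooth_lowerTerm₁ hu hRt hD hf n e
  have h₂ := isSmooth_lowerTerm₂ hu hRt hD hf n e
  have hS₁j : ∀ m, IsSmooth (∑ j, lowerTerm₁ u Rt D n f e m j) := fun m =>
    isSmooth_sum_pi _ fun j _ => h₁ m j
  have hS₁ : IsSmooth (∑ m, ∑ j, lowerTerm₁ u Rt D n f e m j) := isSmooth_sum_pi _ fun m _ => hS₁j m
  have hS₂ab : ∀ m j a, IsSmooth (∑ b, lowerTerm₂ u Rt D n f e m j a b) := fun m j a =>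
    isSmooth_sum_pi _ fun b _ => h₂ m j a b
  have hS₂a : ∀ m j, IsSmooth (∑ a, ∑ b, lowerTerm₂ u Rt D n f e m j a b) := fun m j =>
    isSmooth_sum_pi _ fun a _ => hS₂ab m j a
  have hS₂j : ∀ m, IsSmooth (∑ j, ∑ a, ∑ b, lowerTerm₂ u Rt D n f e m j a b) := fun m =>
    isSmooth_sum_pi _ fun j _ => hS₂a m j
  have hS₂ : IsSmooth (∑ m, ∑ j, ∑ a, ∑ b, lowerTerm₂ u Rt D n f e m j a b) :=
    isSmooth_sum_pi _ fun m _ => hS₂j m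
  have hdivL := isSmooth_tensorDivergence_levelTensor hu hRt hD hf n e
  have hdec : (fun x => (f x * phaseComp u Rt D n x) • e) =
      (n : ℝ)⁻¹ • (Torus.tensorDivergence (levelTensor u Rt D n f e) -
        (∑ m, ∑ j, lowerTerm₁ u Rt D n f e m j) - ∑ m, ∑ j, ∑ a, ∑ b, lowerTerm₂ u Rt D n f e m j a b) := by
    rw [smul_phaseComp_eq_telescope hu h0 hRt hD hdet hf hn e]
    funext x
    simp only [lowerTerm₁, lowerTerm₂, Pi.smul_apply, Pi.sub_apply, Finset.sum_apply]
  rw [hdec, Torus.antidivergence_const_smul ((hdivL.sub hS₁).sub hS₂),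
    Torus.antidivergence_sub (hdivL.sub hS₁) hS₂, Torus.antidivergence_sub hdivL hS₁,
    antidivergence_finset_sum _ fun m _ => hS₁j m, antidivergence_finset_sum _ fun m _ => hS₂j m]
  congr 2
  · congr 1
    exact Finset.sum_congr rfl fun m _ => antidivergence_finset_sum _ fun j _ => h₁ m j
  · refine Finset.sum_congr rfl fun m _ => ?_
    rw [antidivergence_finset_sum _ fun j _ => hS₂a m j]
    refine Finset.sum_congr rfl fun j _ => ?_
    rw [antidivergence_finset_sum _ fun a _ => hS₂ab m j a]
    exact Finset.sum_congr rfl fun a _ => antidivergence_finset_sum _ fun b _ => h₂ m j a b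

/-- **The Schauder step with given bounds**: if `‖L‖_{0,r} ≤ B_L`, each `‖ℛ(lowerTerm)‖_{0,r} ≤ B'`
and `‖ℛ div A‖_{0,r} ≤ C_d ‖A‖_{0,r}`, then `‖ℛ((f c_u)•e)‖_{0,r} ≤ n⁻¹ (C_d B_L + 90 B')`.
[cite: BuckmasterEtAl2018, App. C Prop. C.2 (proof)] -/
theorem holder_antidivergence_smul_phaseComp_le_of_bounds (hu : JointSmooth u)
    (h0 : ∀ R, ∫ ξ, u R ξ = 0) (hRt : IsSmooth Rt) (hD : IsSmooth D) (hdet : ∀ x, (jac D x).det = 1)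
    (hf : IsSmooth f) (hn : 0 < n) (e : ℝ³) {r : ℝ≥0} {Cd : ℝ≥0}
    (hCd : ∀ A : 𝕋³ → Fin 3 → ℝ³, IsSmooth A →
      Torus.eContDiffHolderNorm 0 r (Torus.antidivergence (Torus.tensorDivergence A)) ≤
        Cd * Torus.eContDiffHolderNorm 0 r A)
    {BL B' : ℝ} (hBL : 0 ≤ BL) (hB' : 0 ≤ B')
    (hL : Torus.eContDiffHolderNorm 0 r (levelTensor u Rt D n f e) ≤ ENNReal.ofReal BL)
    (h₁ : ∀ m j, Torus.eContDiffHolderNorm 0 r (Torus.antidivergence (lowerTerm₁ u Rt D n f e m j)) ≤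
      ENNReal.ofReal B')
    (h₂ : ∀ m j a b, Torus.eContDiffHolderNorm 0 r
      (Torus.antidivergence (lowerTerm₂ u Rt D n f e m j a b)) ≤ ENNReal.ofReal B') :
    Torus.eContDiffHolderNorm 0 r (Torus.antidivergence fun x => (f x * phaseComp u Rt D n x) • e) ≤
      ENNReal.ofReal ((n : ℝ)⁻¹ * (Cd * BL + 90 * B')) := by
  have hnr : (0 : ℝ) < n := Nat.cast_pos.2 hn
  have hRsm : ∀ w : 𝕋³ → ℝ³, IsSmooth w → IsSmooth (Torus.antidivergence w) := fun w hw =>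
    Torus.isSmooth_antidivergence hw
  have hR₁ : ∀ m j, IsSmooth (Torus.antidivergence (lowerTerm₁ u Rt D n f e m j)) := fun m j =>
    hRsm _ (isSmooth_lowerTerm₁ hu hRt hD hf n e m j)
  have hR₂ : ∀ m j a b, IsSmooth (Torus.antidivergence (lowerTerm₂ u Rt D n f e m j a b)) :=
    fun m j a b => hRsm _ (isSmooth_lowerTerm₂ hu hRt hD hf n e m j a b)
  have hRL := hRsm _ (isSmooth_tensorDivergence_levelTensor hu hRt hD hf n e)
  -- the three pieces
  set T₁ : 𝕋³ → Fin 3 → ℝ³ := ∑ m, ∑ j, Torus.antidivergence (lowerTerm₁ u Rt D n f e m j) with hT₁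
  set T₂ : 𝕋³ → Fin 3 → ℝ³ := ∑ m, ∑ j, ∑ a, ∑ b, Torus.antidivergence (lowerTerm₂ u Rt D n f e m j a b)
    with hT₂
  have hT₁s : IsSmooth T₁ := isSmooth_sum_pi _ fun m _ => isSmooth_sum_pi _ fun j _ => hR₁ m j
  have hT₂s : IsSmooth T₂ := isSmooth_sum_pi _ fun m _ => isSmooth_sum_pi _ fun j _ =>
    isSmooth_sum_pi _ fun a _ => isSmooth_sum_pi _ fun b _ => hR₂ m j a b
  have h9 : (3 : ℝ≥0∞) * (3 * ENNReal.ofReal B') = ENNReal.ofReal (9 * B') := by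
    rw [← mul_assoc, show (3 : ℝ≥0∞) * 3 = ((9 : ℕ) : ℝ≥0∞) by norm_num, natCast_mul_ofReal]
    push_cast
    rfl
  have h81 : (3 : ℝ≥0∞) * (3 * (3 * (3 * ENNReal.ofReal B'))) = ENNReal.ofReal (81 * B') := by
    rw [← mul_assoc, ← mul_assoc, ← mul_assoc,
      show (3 : ℝ≥0∞) * 3 * 3 * 3 = ((81 : ℕ) : ℝ≥0∞) by norm_num, natCast_mul_ofReal]
    push_cast
    rfl
  have hN₁ : Torus.eContDiffHolderNorm 0 r T₁ ≤ ENNReal.ofReal (9 * B') := by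
    rw [hT₁]
    refine (Torus.eContDiffHolderNorm_sum_le _ fun m _ =>
      (isSmooth_sum_pi _ fun j _ => hR₁ m j).isContDiff (by simp)).trans ?_
    refine (Finset.sum_le_sum fun m _ => (Torus.eContDiffHolderNorm_sum_le _ fun j _ =>
      (hR₁ m j).isContDiff (by simp)).trans (Finset.sum_le_sum fun j _ => h₁ m j)).trans ?_
    rw [sum_fin_three_const, sum_fin_three_const, h9]
  have hN₂ : Torus.eContDiffHolderNorm 0 r T₂ ≤ ENNReal.ofReal (81 * B') := by
    rw [hT₂]
    refine (Torus.eContDiffHolderNorm_sum_le _ fun m _ =>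
      (isSmooth_sum_pi _ fun j _ => isSmooth_sum_pi _ fun a _ => isSmooth_sum_pi _ fun b _ =>
        hR₂ m j a b).isContDiff (by simp)).trans ?_
    refine (Finset.sum_le_sum fun m _ => (Torus.eContDiffHolderNorm_sum_le _ fun j _ =>
      (isSmooth_sum_pi _ fun a _ => isSmooth_sum_pi _ fun b _ => hR₂ m j a b).isContDiff (by simp)).trans
      (Finset.sum_le_sum fun j _ => (Torus.eContDiffHolderNorm_sum_le _ fun a _ =>
        (isSmooth_sum_pi _ fun b _ => hR₂ m j a b).isContDiff (by simp)).trans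
        (Finset.sum_le_sum fun a _ => (Torus.eContDiffHolderNorm_sum_le _ fun b _ =>
          (hR₂ m j a b).isContDiff (by simp)).trans (Finset.sum_le_sum fun b _ => h₂ m j a b)))).trans ?_
    rw [sum_fin_three_const, sum_fin_three_const, sum_fin_three_const, sum_fin_three_const, h81]
  have hNL : Torus.eContDiffHolderNorm 0 r
      (Torus.antidivergence (Torus.tensorDivergence (levelTensor u Rt D n f e))) ≤
      ENNReal.ofReal (Cd * BL) := by
    refine ((hCd _ (isSmooth_levelTensor hu hRt hD hf n e)).trans
      (mul_le_mul_of_nonneg_left hL bot_le)).trans ?_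
    rw [coe_nnreal_eq_ofReal, ← ENNReal.ofReal_mul (NNReal.coe_nonneg _)]
  -- combine
  rw [antidivergence_smul_phaseComp_eq hu h0 hRt hD hdet hf hn.ne' e, ← hT₁, ← hT₂,
    Torus.eContDiffHolderNorm_const_smul (((hRL.sub hT₁s).sub hT₂s).isContDiff (by simp))]
  have htri : Torus.eContDiffHolderNorm 0 r (Torus.antidivergence (Torus.tensorDivergence
      (levelTensor u Rt D n f e)) - T₁ - T₂) ≤ ENNReal.ofReal (Cd * BL + 9 * B' + 81 * B') := by
    refine (Torus.eContDiffHolderNorm_sub_le ((hRL.sub hT₁s).isContDiff (by simp))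
      (hT₂s.isContDiff (by simp))).trans ?_
    refine (add_le_add ((Torus.eContDiffHolderNorm_sub_le (hRL.isContDiff (by simp))
      (hT₁s.isContDiff (by simp))).trans (add_le_add hNL hN₁)) hN₂).trans ?_
    rw [← ENNReal.ofReal_add (by positivity) (by positivity),
      ← ENNReal.ofReal_add (by positivity) (by positivity)]
  refine (mul_le_mul (le_of_eq (Real.enorm_eq_ofReal (inv_nonneg.2 hnr.le))) htri bot_le bot_le).trans ?_
  rw [← ENNReal.ofReal_mul (inv_nonneg.2 hnr.le)]
  exact ENNReal.ofReal_le_ofReal (le_of_eq (by ring))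

/-- **The level tensor in `C^{0,r}`**: `‖L‖_{0,r} ≤ 9 · 79 Λ² ‖e‖ (6FΛ) U n^r` when
`‖f‖_{C^j} ≤ Fℓ^{-j}` (`j ≤ 1`) and the profiles `Tⱼu` have order-one bounds `U`
(columns, then the basic product bound). [folklore] -/
theorem PhaseFrame.holder_levelTensor_le (hP : PhaseFrame Rt D n K₀ ℓ Λ Kset) (hK : 1 ≤ K₀)
    (hnl : 1 ≤ (n : ℝ) * ℓ) (hJ : ∀ x k m, |jac D x k m| ≤ Λ) (hu : JointSmooth u) (hf : IsSmooth f)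
    {F : ℝ} (hF : 0 ≤ F) (hfB : ScaledBound f 1 ℓ F) {U : ℝ} (hU : 0 ≤ U)
    (hPw : ∀ j, ProfileBound (fun R => torusPrim (u R) j) Kset U) (e : ℝ³) {r : ℝ≥0} (hr1 : r ≤ 1) :
    Torus.eContDiffHolderNorm 0 r (levelTensor u Rt D n f e) ≤
      ENNReal.ofReal (4266 * Λ ^ 3 * ‖e‖ * F * U * (n : ℝ) ^ (r : ℝ)) := by
  have hℓ := hP.ℓ_pos
  have hΛ0 : 0 ≤ Λ := zero_le_one.trans hP.one_le_Λ
  have hA : ∀ m j, IsSmooth fun y => (jac D y).adjugate m j := fun m j =>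
    isSmooth_adjugate_jac_entry hP.smooth_D m j
  have hfA : ∀ m j, IsSmooth fun y => f y * (jac D y).adjugate m j := fun m j => hf.mul (hA m j)
  have hfAB : ∀ m j, ScaledBound (fun y => f y * (jac D y).adjugate m j) 1 ℓ (6 * F * Λ) := by
    intro m j
    refine (hfB.mul ((hP.adj_bound m j).mono_N hK) hf (hA m j) hF hΛ0 hℓ).mono_M (le_of_eq ?_) hℓ
    norm_num
  have hterm : ∀ m j, Torus.eContDiffHolderNorm 0 r (fun x => ((f x * (jac D x).adjugate m j) *
      phaseComp (fun R => torusPrim (u R) j) Rt D n x) • e) ≤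
      ENNReal.ofReal (79 * Λ ^ 2 * ‖e‖ * (6 * F * Λ) * U * (n : ℝ) ^ (r : ℝ)) := fun m j =>
    hP.holder_mul_phaseComp_smul_le hK hnl hJ (hfA m j) (by positivity) (hfAB m j) (hu.torusPrim j) hU
      (hPw j) e hr1
  have hLs := isSmooth_levelTensor hu hP.smooth_Rt hP.smooth_D hf n e
  have hcol : ∀ m, Torus.eContDiffHolderNorm 0 r (fun x => levelTensor u Rt D n f e x m) ≤
      3 * ENNReal.ofReal (79 * Λ ^ 2 * ‖e‖ * (6 * F * Λ) * U * (n : ℝ) ^ (r : ℝ)) := by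
    intro m
    have heq : (fun x => levelTensor u Rt D n f e x m) = ∑ j : Fin 3, fun x =>
        ((f x * (jac D x).adjugate m j) * phaseComp (fun R => torusPrim (u R) j) Rt D n x) • e := by
      funext x
      simp only [levelTensor, Finset.sum_apply, Finset.sum_smul]
    rw [heq]
    refine (Torus.eContDiffHolderNorm_sum_le _ fun j _ => ?_).trans ?_
    · exact (((hfA m j).mul ((hu.torusPrim j).phaseComp hP.smooth_Rt hP.smooth_D n)).smul'
        (isSmooth_const e)).isContDiff (by simp)
    refine (Finset.sum_le_sum fun j _ => hterm m j).trans ?_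
    rw [sum_fin_three_const]
  refine (eContDiffHolderNorm_zero_le_sum_columns r fun m => (hLs.column m).isContDiff (by simp)).trans ?_
  refine (Finset.sum_le_sum fun m _ => hcol m).trans ?_
  rw [sum_fin_three_const, ← mul_assoc, show (3 : ℝ≥0∞) * 3 = ((9 : ℕ) : ℝ≥0∞) by norm_num,
    natCast_mul_ofReal]
  push_cast
  exact ENNReal.ofReal_le_ofReal (le_of_eq (by ring))

/-- The arithmetic of the inductive step: with `X = ‖e‖FU`, `P = n^{-1+r}`, `N_r = n^r`,
`q = (nℓ)⁻¹ ≤ 1`, `c ≥ 1`,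
`n⁻¹ (C_d · 4266Λ³ X N_r + 90 · X c²Λ² ℓ⁻¹ (aP + bN_r q^K)) ≤ X ((90c²Λ²a + 4266 c C_d Λ³) P + 90c²Λ² b N_r q^{K+1})`.
[folklore] -/
theorem step_arith {ni ℓi c Λ Cd a b X P Nr q : ℝ} {K : ℕ} (hc : 1 ≤ c) (hΛ : 0 ≤ Λ) (hCd : 0 ≤ Cd)
    (ha : 0 ≤ a) (hX : 0 ≤ X) (hP : 0 ≤ P) (hq1 : q ≤ 1)
    (hPN : ni * Nr = P) (hq : ni * ℓi = q) :
    ni * (Cd * (4266 * Λ ^ 3 * X * Nr) + 90 * (X * (c ^ 2 * Λ ^ 2 * ℓi) * (a * P + b * Nr * q ^ K))) ≤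
      X * ((90 * c ^ 2 * Λ ^ 2 * a + 4266 * c * Cd * Λ ^ 3) * P + 90 * c ^ 2 * Λ ^ 2 * b * Nr * q ^ (K + 1)) := by
  have e1 : ni * (Cd * (4266 * Λ ^ 3 * X * Nr) + 90 * (X * (c ^ 2 * Λ ^ 2 * ℓi) * (a * P + b * Nr * q ^ K))) =
      4266 * Cd * Λ ^ 3 * X * (ni * Nr) + 90 * (c ^ 2 * Λ ^ 2 * X * ((ni * ℓi) * (a * P + b * Nr * q ^ K))) := by
    ring
  rw [e1, hPN, hq]
  have h_one : 0 ≤ Cd * Λ ^ 3 * X * P * (c - 1) := by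
    have : 0 ≤ c - 1 := by linarith
    positivity
  have h_two : 0 ≤ c ^ 2 * Λ ^ 2 * X * (a * P) * (1 - q) := by
    have : 0 ≤ 1 - q := by linarith
    positivity
  rw [pow_succ q K]
  nlinarith [h_one, h_two]

/-- **The inductive step** of the `ℛ` level bound: one more integration by parts improves the
remainder by `(nℓ)⁻¹`, at the price of the exact-divergence term `n⁻¹ ℛ div L` (bounded through
`C_d`), which is the main term `n^{-(1-r)}`. With `c = leibConst K₀`:
`a ↦ 90c²Λ² a + 4266 c C_d Λ³`, `b ↦ 90 c²Λ² b`. [cite: BuckmasterEtAl2018, App. C Prop. C.2 (proof)] -/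
theorem PhaseFrame.levelBoundR_succ (hP : PhaseFrame Rt D n K₀ ℓ Λ Kset) {K : ℕ} (hK : K + 2 ≤ K₀)
    (hnl : 1 ≤ (n : ℝ) * ℓ) (hJ : ∀ x k m, |jac D x k m| ≤ Λ) (hr1 : r ≤ 1)
    (hCd : ∀ A : 𝕋³ → Fin 3 → ℝ³, IsSmooth A →
      Torus.eContDiffHolderNorm 0 r (Torus.antidivergence (Torus.tensorDivergence A)) ≤
        Cd * Torus.eContDiffHolderNorm 0 r A)
    {a b : ℝ} (ha : 0 ≤ a) (hb : 0 ≤ b) (ih : LevelBoundR Rt D n ℓ Kset r e a b K) :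
    LevelBoundR Rt D n ℓ Kset r e
      (90 * leibConst K₀ ^ 2 * Λ ^ 2 * a + 4266 * leibConst K₀ * Cd * Λ ^ 3)
      (90 * leibConst K₀ ^ 2 * Λ ^ 2 * b) (K + 1) := by
  intro u f F U hu h0 hf hF hfB hU hUB
  -- constants
  set c : ℝ := leibConst K₀ with hcdef
  have hc1 : 1 ≤ c := one_le_leibConst K₀
  have hc0 : 0 ≤ c := zero_le_one.trans hc1
  have hℓ := hP.ℓ_pos
  have hΛ1 := hP.one_le_Λ
  have hΛ0 : 0 ≤ Λ := zero_le_one.trans hΛ1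
  have hnr : (0 : ℝ) < n := Nat.cast_pos.2 hP.n_pos
  have hli : 0 ≤ ℓ⁻¹ := inv_nonneg.2 hℓ.le
  have hK1 : 1 ≤ K₀ := le_trans (by omega) hK
  set q : ℝ := ((n : ℝ) * ℓ)⁻¹ with hqdef
  have hq1 : q ≤ 1 := inv_le_one_of_one_le₀ hnl
  -- the profiles one level down, their zero means and bound families
  have hwj : ∀ j, JointSmooth (fun R => torusPrim (u R) j) := fun j => hu.torusPrim j
  have hw0 : ∀ j (R : 𝕄), ∫ ξ, torusPrim (u R) j ξ = 0 := fun j R => integral_torusPrim (hu.isSmooth R) j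
  have hwR : ∀ j a b, JointSmooth (dR (Matrix.single a b 1) fun R => torusPrim (u R) j) :=
    fun j a b => (hwj j).dR _
  have hwR0 : ∀ j a b (R : 𝕄), ∫ ξ, dR (Matrix.single a b 1) (fun R => torusPrim (u R) j) R ξ = 0 :=
    fun j a b R => (hwj j).integral_dR (hw0 j) _ R
  have hUw : ∀ j, BoundFam K (fun R => torusPrim (u R) j) Kset U := fun j => (hUB.2 j).1
  have hUwR : ∀ j a b, BoundFam K (dR (Matrix.single a b 1) fun R => torusPrim (u R) j) Kset U :=
    fun j a b => (hUB.2 j).2 a b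
  have hPw : ∀ j, ProfileBound (fun R => torusPrim (u R) j) Kset U := fun j => (hUw j).profileBound
  -- the amplitudes one level down and their scaled bounds
  have hA : ∀ m j, IsSmooth fun y => (jac D y).adjugate m j := fun m j =>
    isSmooth_adjugate_jac_entry hP.smooth_D m j
  have hAB : ∀ m j, ScaledBound (fun y => (jac D y).adjugate m j) (K + 2) ℓ Λ := fun m j =>
    (hP.adj_bound m j).mono_N hK
  have hfA : ∀ m j, IsSmooth fun y => f y * (jac D y).adjugate m j := fun m j => hf.mul (hA m j)
  have hfAB : ∀ m j, ScaledBound (fun y => f y * (jac D y).adjugate m j) (K + 2) ℓ (c * F * Λ) := by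
    intro m j
    refine (hfB.mul (hAB m j) hf (hA m j) hF hΛ0 hℓ).mono_M ?_ hℓ
    have h := leib_le (N := K + 2) (K₀ := K₀) (by omega)
    push_cast at h ⊢
    have hFΛ : 0 ≤ F * Λ := mul_nonneg hF hΛ0
    nlinarith [mul_le_mul_of_nonneg_right h hFΛ]
  have hRtd : ∀ m a b, IsSmooth (Torus.partialDeriv m fun y => Rt y a b) := fun m a b =>
    (isSmooth_entry hP.smooth_Rt a b).partialDeriv m
  have hRtdB : ∀ m a b, ScaledBound (Torus.partialDeriv m fun y => Rt y a b) (K + 1) ℓ (Λ * ℓ⁻¹) :=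
    fun m a b => ((hP.Rt_bound a b).mono_N hK).partialDeriv (isSmooth_entry hP.smooth_Rt a b) m
  set F' : ℝ := c ^ 2 * Λ ^ 2 * F * ℓ⁻¹ with hF'def
  have hF' : 0 ≤ F' := by positivity
  have hf₁B : ∀ m j, ScaledBound (Torus.partialDeriv m fun y => f y * (jac D y).adjugate m j) (K + 1) ℓ F' := by
    intro m j
    refine ((hfAB m j).partialDeriv (hfA m j) m).mono_M ?_ hℓ
    rw [hF'def]
    have : c * F * Λ ≤ c ^ 2 * Λ ^ 2 * F := by
      have hFc : 0 ≤ c * F * Λ := by positivity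
      nlinarith [mul_le_mul hc1 hΛ1 zero_le_one hc0]
    exact mul_le_mul_of_nonneg_right this hli
  have hf₂B : ∀ m j a b, ScaledBound (fun x => f x * (jac D x).adjugate m j *
      Torus.partialDeriv m (fun y => Rt y a b) x) (K + 1) ℓ F' := by
    intro m j a b
    have h1 := ((hfAB m j).mono_N (Nat.le_succ _)).mul (hRtdB m a b) (hfA m j) (hRtd m a b)
      (by positivity) (by positivity) hℓ
    refine h1.mono_M ?_ hℓ
    have h := leib_le (N := K + 1) (K₀ := K₀) (by omega)
    push_cast at h ⊢
    rw [hF'def]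
    have hX : 0 ≤ c * F * Λ * (Λ * ℓ⁻¹) := by positivity
    nlinarith [mul_le_mul_of_nonneg_right h hX]
  -- the induction hypothesis on the `9 + 81` lower terms
  set B' : ℝ := ‖e‖ * F' * U * (a * (n : ℝ) ^ (-1 + (r : ℝ)) + b * (n : ℝ) ^ (r : ℝ) * q ^ K)
    with hB'def
  have hB' : 0 ≤ B' := by positivity
  have hI₁ : ∀ m j, Torus.eContDiffHolderNorm 0 r (Torus.antidivergence (lowerTerm₁ u Rt D n f e m j)) ≤
      ENNReal.ofReal B' :=
    fun m j => ih _ _ F' U (hwj j) (hw0 j) ((hfA m j).partialDeriv m) hF' (hf₁B m j) hU (hUw j)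
  have hI₂ : ∀ m j a b, Torus.eContDiffHolderNorm 0 r
      (Torus.antidivergence (lowerTerm₂ u Rt D n f e m j a b)) ≤ ENNReal.ofReal B' :=
    fun m j a b => ih _ _ F' U (hwR j a b) (hwR0 j a b) ((hfA m j).mul (hRtd m a b)) hF'
      (hf₂B m j a b) hU (hUwR j a b)
  -- the level tensor
  set BL : ℝ := 4266 * Λ ^ 3 * ‖e‖ * F * U * (n : ℝ) ^ (r : ℝ) with hBLdef
  have hBL : 0 ≤ BL := by positivity
  have hLB : Torus.eContDiffHolderNorm 0 r (levelTensor u Rt D n f e) ≤ ENNReal.ofReal BL :=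
    hP.holder_levelTensor_le hK1 hnl hJ hu hf hF (hfB.mono_N (by omega)) hU hPw e hr1
  -- the Schauder step and the arithmetic
  refine (holder_antidivergence_smul_phaseComp_le_of_bounds hu h0 hP.smooth_Rt hP.smooth_D hP.det_jac
    hf hP.n_pos e hCd hBL hB' hLB hI₁ hI₂).trans (ENNReal.ofReal_le_ofReal ?_)
  have hPN : (n : ℝ)⁻¹ * (n : ℝ) ^ (r : ℝ) = (n : ℝ) ^ (-1 + (r : ℝ)) := by
    rw [Real.rpow_add hnr, Real.rpow_neg_one]
  have hq : (n : ℝ)⁻¹ * ℓ⁻¹ = q := by rw [hqdef, mul_inv]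
  have h := step_arith (K := K) (b := b) hc1 hΛ0 (NNReal.coe_nonneg Cd) ha
    (by positivity : 0 ≤ ‖e‖ * F * U) (Real.rpow_nonneg hnr.le _) hq1 hPN hq
  convert h using 1
  rw [hBLdef, hB'def, hF'def]; ring

/-- **The `ℛ` level bound at every level**: coefficients `aₖ, bₖ` (recursively from level `0`)
such that `LevelBoundR … aₖ bₖ K` holds for `K + 1 ≤ K₀`. [folklore] -/
def aCoeff (K₀ : ℕ) (Λ Cd : ℝ) : ℕ → ℝ
  | 0 => 0
  | K + 1 => 90 * leibConst K₀ ^ 2 * Λ ^ 2 * aCoeff K₀ Λ Cd K + 4266 * leibConst K₀ * Cd * Λ ^ 3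

/-- The remainder coefficient `bₖ = (90 c² Λ²)^k · 79 Λ² C_r`. [folklore] -/
def bCoeff (K₀ : ℕ) (Λ Cr : ℝ) : ℕ → ℝ
  | 0 => 79 * Λ ^ 2 * Cr
  | K + 1 => 90 * leibConst K₀ ^ 2 * Λ ^ 2 * bCoeff K₀ Λ Cr K

/-- `0 ≤ aCoeff`. [folklore] -/
theorem aCoeff_nonneg (K₀ : ℕ) {Λ Cd : ℝ} (hΛ : 0 ≤ Λ) (hCd : 0 ≤ Cd) : ∀ K, 0 ≤ aCoeff K₀ Λ Cd K
  | 0 => le_rfl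
  | K + 1 => by
    have := aCoeff_nonneg K₀ hΛ hCd K
    have := one_le_leibConst K₀
    unfold aCoeff; positivity

/-- `0 ≤ bCoeff`. [folklore] -/
theorem bCoeff_nonneg (K₀ : ℕ) {Λ Cr : ℝ} (hΛ : 0 ≤ Λ) (hCr : 0 ≤ Cr) : ∀ K, 0 ≤ bCoeff K₀ Λ Cr K
  | 0 => by unfold bCoeff; positivity
  | K + 1 => by
    have := bCoeff_nonneg K₀ hΛ hCr K
    have := one_le_leibConst K₀
    unfold bCoeff; positivity

/-- **The `ℛ` level bound** in a phase frame of level `K₀` with `nℓ ≥ 1` and `|∇Φ| ≤ Λ`: for every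
`K` with `K + 1 ≤ K₀`, `LevelBoundR` holds with the coefficients `aCoeff K₀ Λ C_d K`,
`bCoeff K₀ Λ C_r K`. [cite: BuckmasterEtAl2018, App. C Prop. C.2] -/
theorem PhaseFrame.levelBoundR (hP : PhaseFrame Rt D n K₀ ℓ Λ Kset) (hnl : 1 ≤ (n : ℝ) * ℓ)
    (hJ : ∀ x k m, |jac D x k m| ≤ Λ) (hr1 : r ≤ 1)
    (hCd : ∀ A : 𝕋³ → Fin 3 → ℝ³, IsSmooth A →
      Torus.eContDiffHolderNorm 0 r (Torus.antidivergence (Torus.tensorDivergence A)) ≤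
        Cd * Torus.eContDiffHolderNorm 0 r A)
    (hCr : ∀ w : 𝕋³ → ℝ³, IsSmooth w →
      Torus.eContDiffHolderNorm 0 r (Torus.antidivergence w) ≤ Cr * Torus.eContDiffHolderNorm 0 r w)
    (e : ℝ³) : ∀ K, K + 1 ≤ K₀ → LevelBoundR Rt D n ℓ Kset r e (aCoeff K₀ Λ Cd K) (bCoeff K₀ Λ Cr K) K := by
  have hΛ0 : 0 ≤ Λ := zero_le_one.trans hP.one_le_Λ
  intro K
  induction K with
  | zero => exact fun hK => hP.levelBoundR_zero hK hnl hJ hr1 hCr e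
  | succ K ihK =>
    intro hK
    exact hP.levelBoundR_succ hK hnl hJ hr1 hCd (aCoeff_nonneg K₀ hΛ0 (NNReal.coe_nonneg Cd) K)
      (bCoeff_nonneg K₀ hΛ0 (NNReal.coe_nonneg Cr) K) (ihK (by omega))

end Level





end BDSV

end Literature.Analysis.FluidPDE
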